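import Summits.QuantumFields.GaugeBoot.GaugeInvariantBootstrap
import Summits.QuantumFields.GaugeBoot.BootstrapLatticeSymmetry
import HarnessLib

/-!
# Translations commute with the gauge average: the bootstrap on gauge-invariant data needs its loop equations at one site only (gauge-boot, L1 supplement)

HONEST FRAMING (cell `pub-gaugeboot`, page 1 of every file): the venture produces certified bounds
on lattice expectations at stated coupling, gauge group, dimension and torus size; NOT a mass gap,
NOT a continuum limit, NOT a string tension; NOT Yang–Mills-summit-bearing (barriers
`FixedCouplingUltralocality`, `PerturbativeInvisibility`). Structural; it certifies no number.

## Content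

`BootstrapLatticeSymmetry.lean` reduces the loop equations of a translation-invariant functional to
the `d` links at the origin. Here the same for the bootstrap on GAUGE-INVARIANT data
(`GaugeInvariantBootstrap.lean`, functional `ψ ∘ₗ A`, `A = gaugeAvgL` the gauge average):

* `integral_comp_equiv_haarProbability_pi` — relabelling the factors of a product of compact groups
  preserves its Haar probability measure (uniqueness of Haar measure, `MonoidHom.measurePreserving`);
* `gaugeTransform_comp_translateEquiv` — translating a gauge-transformed configuration = gauge
  transforming the translated configuration by the translated gauge function;
* ★★ `gaugeAvgL_comp_translate` — THE GAUGE AVERAGE COMMUTES WITH TRANSLATIONS,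
  `A (f ∘ τ_a) = (A f) ∘ τ_a`; hence `comp_gaugeAvgL_translationInvariant` — if `ψ` is translation
  invariant on the gauge-invariant polynomials then `ψ ∘ₗ A` is translation invariant on all
  polynomials;
* ★★★ `eq_wilson_of_gaugeInvariantBootstrap_baseRows_suN` / `_uN` — `SU(N)` / `U(N)` on `(ℤ/L)^d`,
  ANY real `β`: a linear `ψ`, translation invariant on the gauge-invariant polynomials, with
  `ψ 1 = 1`, loop positivity (P_G) and the gauge-averaged loop equations AT THE `d` BASE LINKS
  `(0, i)` ONLY, gives every gauge-invariant polynomial observable its Wilson expectation.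

What this is NOT: axis permutations / reflections; rates.

References: P. Anderson, M. Kruczenski, Nucl. Phys. B 921 (2017) §3; V. Kazakov, Z. Zheng,
arXiv:2203.11360 §3. Folklore.
-/

noncomputable section

open MeasureTheory Filter Topology NormedSpace
open Literature.MathematicalPhysics.QuantumFieldTheory (haarProbability LatticeRep)

namespace Summit.QuantumFields.GaugeBoot

/-! ## Relabelling the factors of a product Haar measure -/

section HaarPi

variable {X : Type*} [Countable X] {G : Type*} [Group G] [TopologicalSpace G] [IsTopologicalGroup G]
  [CompactSpace G] [MeasurableSpace G] [BorelSpace G] [SecondCountableTopology G]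

/-- **Relabelling the factors preserves the Haar probability measure of a product of compact
groups**: `∫ F (γ ∘ σ) dγ = ∫ F dγ` for `σ : X ≃ X` and continuous `F` (the relabelling is a
continuous surjective group endomorphism; uniqueness of Haar measure). [folklore] -/
theorem integral_comp_equiv_haarProbability_pi (σ : X ≃ X) {F : (X → G) → ℝ} (hF : Continuous F) :
    ∫ γ, F (γ ∘ σ) ∂haarProbability (X → G) = ∫ γ, F γ ∂haarProbability (X → G) := by
  let f : (X → G) →* (X → G) := ⟨⟨fun γ => γ ∘ σ, rfl⟩, fun _ _ => rfl⟩
  have hfc : Continuous f := continuous_pi fun x => continuous_apply (σ x)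
  have hfs : Function.Surjective f := fun γ => ⟨γ ∘ σ.symm, by
    show (γ ∘ σ.symm) ∘ σ = γ
    funext x
    simp⟩
  have hf : MeasurePreserving f (haarProbability (X → G)) (haarProbability (X → G)) :=
    f.measurePreserving hfc hfs rfl
  have h := integral_map hf.measurable.aemeasurable (hF.aestronglyMeasurable (μ := (haarProbability (X → G)).map f))
  rw [hf.map_eq] at h
  exact h.symm

end HaarPi

/-! ## The gauge average commutes with translations -/

section Torus

open Literature.MathematicalPhysics.QuantumFieldTheory (Site Edge GaugeConfig gaugeTransform IsGaugeInvariant)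

variable {d L : ℕ} {G : Type*} [Group G]

/-- **Translating a gauge-transformed configuration** = gauge transforming the translated
configuration by the translated gauge function. -/
theorem gaugeTransform_comp_translateEquiv (γ : Site d L → G) (U : GaugeConfig d L G) (a : Site d L) :
    gaugeTransform γ U ∘ translateEquiv a = gaugeTransform (γ ∘ Equiv.addRight a) (U ∘ translateEquiv a) := by
  funext e
  simp only [Function.comp_apply, translateEquiv_apply, gaugeTransform, Equiv.coe_addRight, Site.shift,
    add_right_comm _ _ a]

variable [TopologicalSpace G] [IsTopologicalGroup G] [CompactSpace G] [MeasurableSpace G] [BorelSpace G]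
  [SecondCountableTopology G] [NeZero L]

/-- ★★ **The gauge average commutes with translations**: `A (f ∘ τ_a) = (A f) ∘ τ_a`. [folklore] -/
theorem gaugeAvgL_comp_translate (f : C(GaugeConfig d L G, ℝ)) (a : Site d L) :
    gaugeAvgL d L G (f.comp (relabelCM (translateEquiv a))) =
      (gaugeAvgL d L G f).comp (relabelCM (translateEquiv a)) := by
  ext U
  rw [ContinuousMap.comp_apply, gaugeAvgL_apply, gaugeAvgL_apply]
  simp only [ContinuousMap.comp_apply, coe_relabelCM]
  simp_rw [gaugeTransform_comp_translateEquiv]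
  exact integral_comp_equiv_haarProbability_pi (Equiv.addRight a)
    (F := fun γ : Site d L → G => f (gaugeTransform γ (U ∘ translateEquiv a)))
    (f.continuous.comp (gaugeTransform_action.2.comp (continuous_id.prodMk continuous_const)))

/-- **If `ψ` is translation invariant on the gauge-invariant polynomials, `ψ ∘ₗ A` is translation
invariant on all polynomials.** -/
theorem comp_gaugeAvgL_translationInvariant (r : LatticeRep G) {ψ : C(GaugeConfig d L G, ℝ) →ₗ[ℝ] ℝ}
    (hψ : ∀ (a : Site d L), ∀ h ∈ polyAlgebra (ι := Edge d L) r, IsGaugeInvariant (⇑h) →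
      ψ (h.comp (relabelCM (translateEquiv a))) = ψ h)
    (a : Site d L) {g : C(GaugeConfig d L G, ℝ)} (hg : g ∈ polyAlgebra (ι := Edge d L) r) :
    (ψ ∘ₗ gaugeAvgL d L G) (g.comp (relabelCM (translateEquiv a))) = (ψ ∘ₗ gaugeAvgL d L G) g := by
  rw [LinearMap.comp_apply, LinearMap.comp_apply, gaugeAvgL_comp_translate]
  exact hψ a _ (gaugeAvgL_mem_polyAlgebra r hg) (isGaugeInvariant_gaugeAvgL g)

end Torus

/-! ## `SU(N)` and `U(N)`: the bootstrap on gauge-invariant data with loop equations at one site -/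

section Unitary

open Literature.MathematicalPhysics.QuantumFieldTheory (Site Edge GaugeConfig IsGaugeInvariant
  wilsonAction wilsonMeasure)
open Literature.MathematicalPhysics.QuantumLattice

variable {d L : ℕ}

/-- ★★★ **`SU(N)` on `(ℤ/L)^d`, ANY real `β`: the bootstrap on gauge-invariant data with the loop
equations AT ONE SITE.** A linear `ψ`, translation invariant on the gauge-invariant polynomial
observables, with `ψ 1 = 1`, loop positivity `0 ≤ ψ (A (a a))`, and the gauge-averaged loop
equations at the `d` base links `(0, i)` only, gives every gauge-invariant polynomial observable its
Wilson expectation. [folklore] -/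
theorem eq_wilson_of_gaugeInvariantBootstrap_baseRows_suN [NeZero L] (N : ℕ) (β : ℝ)
    {ψ : C(GaugeConfig d L (Matrix.specialUnitaryGroup (Fin N) ℂ), ℝ) →ₗ[ℝ] ℝ} (h1 : ψ 1 = 1)
    (hinv : ∀ (a : Site d L), ∀ h ∈ polyAlgebra (ι := Edge d L) (fundamentalLatticeRep N),
      IsGaugeInvariant (⇑h) → ψ (h.comp (relabelCM (translateEquiv a))) = ψ h)
    (hpos : ∀ a ∈ polyAlgebra (ι := Edge d L) (fundamentalLatticeRep N),
      0 ≤ ψ (gaugeAvgL d L _ (a * a)))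
    (hrows : IsSDFunctionalAt (fundamentalLatticeRep N) (Set.range fun i : Fin d => ((0 : Site d L), i))
      (suExp N) (fun _ => wilsonAction (fundamentalRep (Fin N))) β (ψ ∘ₗ gaugeAvgL d L _))
    {a : C(GaugeConfig d L (Matrix.specialUnitaryGroup (Fin N) ℂ), ℝ)}
    (ha : a ∈ polyAlgebra (ι := Edge d L) (fundamentalLatticeRep N)) (hai : IsGaugeInvariant (⇑a)) :
    ψ a = ∫ U, a U ∂(wilsonMeasure (fundamentalRep (Fin N)) β) :=
  eq_wilson_of_gaugeInvariantBootstrap_suN N β h1 hpos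
    (isSDFunctional_of_translationInvariant_suN N β
      (fun b _ hg => comp_gaugeAvgL_translationInvariant _ hinv b hg) hrows) ha hai

/-- ★★★ **`U(N)` on `(ℤ/L)^d`: the bootstrap on gauge-invariant data with the loop equations at
one site.** [folklore] -/
theorem eq_wilson_of_gaugeInvariantBootstrap_baseRows_uN [NeZero L] (N : ℕ) (β : ℝ)
    {ψ : C(GaugeConfig d L (Matrix.unitaryGroup (Fin N) ℂ), ℝ) →ₗ[ℝ] ℝ} (h1 : ψ 1 = 1)
    (hinv : ∀ (a : Site d L), ∀ h ∈ polyAlgebra (ι := Edge d L) (unitaryFundamentalLatticeRep N),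
      IsGaugeInvariant (⇑h) → ψ (h.comp (relabelCM (translateEquiv a))) = ψ h)
    (hpos : ∀ a ∈ polyAlgebra (ι := Edge d L) (unitaryFundamentalLatticeRep N),
      0 ≤ ψ (gaugeAvgL d L _ (a * a)))
    (hrows : IsSDFunctionalAt (unitaryFundamentalLatticeRep N) (Set.range fun i : Fin d => ((0 : Site d L), i))
      (uExp N) (fun _ => wilsonAction (unitaryFundamentalRep (Fin N) ℂ)) β (ψ ∘ₗ gaugeAvgL d L _))
    {a : C(GaugeConfig d L (Matrix.unitaryGroup (Fin N) ℂ), ℝ)}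
    (ha : a ∈ polyAlgebra (ι := Edge d L) (unitaryFundamentalLatticeRep N)) (hai : IsGaugeInvariant (⇑a)) :
    ψ a = ∫ U, a U ∂(wilsonMeasure (unitaryFundamentalRep (Fin N) ℂ) β) :=
  eq_wilson_of_gaugeInvariantBootstrap_uN N β h1 hpos
    (isSDFunctional_of_translationInvariant_uN N β
      (fun b _ hg => comp_gaugeAvgL_translationInvariant _ hinv b hg) hrows) ha hai

/-- **Consistency**: the Wilson expectation functional IS translation invariant on the polynomials
(`integral_comp_translate_eq_wilson_suN`), so the hypothesis `hinv` above is satisfied by the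
solution. (`SU(N)`.) -/
theorem wilson_translationInvariant_suN [NeZero L] (N : ℕ) (β : ℝ)
    (μ : Measure (GaugeConfig d L (Matrix.specialUnitaryGroup (Fin N) ℂ))) [IsProbabilityMeasure μ]
    (hμ : μ = wilsonMeasure (fundamentalRep (Fin N)) β) (a : Site d L)
    {h : C(GaugeConfig d L (Matrix.specialUnitaryGroup (Fin N) ℂ), ℝ)}
    (hh : h ∈ polyAlgebra (ι := Edge d L) (fundamentalLatticeRep N)) :
    expectationFunctional μ (h.comp (relabelCM (translateEquiv a))) = expectationFunctional μ h := by
  subst hμ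
  rw [expectationFunctional_apply, expectationFunctional_apply]
  exact integral_comp_translate_eq_wilson_suN N β a hh

end Unitary

end Summit.QuantumFields.GaugeBoot

end
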